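import Summits.BirchSwinnertonDyer.BirchSwinnertonDyer.Theorems.ClassRecordThreeCartanBorelGhost
import Summits.BirchSwinnertonDyer.BirchSwinnertonDyer.Theorems.ClassRecordThreeCartanCuspRowGhost
import HarnessLib

/-!
# (RBG) THE RATIONAL BOREL GHOST LEMMA, PROVED — borelghost §R.4

Lift-only port (cell bsd-stepL, SUMMON key `ghostlift`, director-bsd (837) «(κ2) GHOSTLIFT: GO NOW» 2026-08-31; lift by tam3-p1 g43) of §R.4 (source lines 2381–2582, `section BorelGhost`) of the crux-ideate workfile
`Summits/BirchSwinnertonDyer/BirchSwinnertonDyer/Cruxes/CartanOnePlaceDegreeLawAtThree/Lines/borelghost.lean` (lineage `cruxidea-stmt-BirchSwinnertonDyer-24801-1`, generation 30, commit db8906745aa4, sha256-16 4139cfefd1941dbf, 2747 l.; farm rc 0, sorries 5 = its §4 stubs, none of which is lifted; referee FULL BATTERY PASS `VERDICT-BORELGHOST-G30-g94.md`).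
AUTHORS OF THE BYTES: cruxidea-24801 generation 30 (`borelghost`, §R.4). Declarations, statements and proofs below are token-identical to the source; the only edits are the namespace
(`…Cruxes.CartanOnePlaceDegreeLawAtThree.Borelghost` ↦ `…Theorems.CartanDoubleCoset`, shared with the `ClassRecordThreeCartanSupply*` lift modules), the imports ∕ `open`s ∕
section preamble each module needs, and one-line docstrings added where the source had none. Nothing is re-stated, weakened or re-proved.

CONTENT (finite group theory of `G = GL₂(𝔽_q)`, `q` odd prime). `rationalBorelGhost`: `W` an IRREDUCIBLE finite-dimensional `ℂ[G]`-module with INTEGER-valued character,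
`w ≠ 0` a vector on which the upper-triangular Borel subgroup acts by scalars `lam b` and which is fixed by the scalar matrices; then `lam t ^ 4 = 1 ∨ lam t ^ 6 = 1` at every
DIAGONAL `t`. Proof (verbatim): `lam` is multiplicative on `B`, non-zero, trivial on `N` and on scalars; `P = Σ_y ρ(n y)` maps `W = ℂ[G]·w` into `ℂw + ℂu'` (Bruhat), the
JACQUET TRACE IDENTITY `tr(ρ(t) ∘ P) = q · tr ρ(t) ∈ qℤ` reads `lam t ∈ ℤ` or `lam t + (lam t)⁻¹ ∈ ℤ`, then Niven (`dvd_four_or_dvd_six_of_intTrace` of `…CuspRowGhost`).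
Not lifted (stay in the lineage workfile): §R.5 and §P.3, which consume the workfile-only statements (NCB₂₄₆) ∕ (JV₇).

HONEST: a `--supports stmt-BirchSwinnertonDyer-24801 --as helper` module of PROVED finite-group theory ∕ lattice bookkeeping; it closes NO registered stub and NO leaf of
24801 — the five stubs of registry `Lines/jacquet.lean` rev 10.1 ((JV) · (NCB) · (CV♭) · (DS) ∧ (JLᶜ) · (MO1ᴾ)) stand, the registry is untouched by this module, no count moves
(1∕12 · 0∕12), nothing about NUM ∕ NUM♮ ∕ 24801 ∕ 32276 ∕ 19109 is proved for any curve; BSD is proved for no curve.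
-/

set_option linter.dupNamespace false  -- `Summit.BirchSwinnertonDyer.BirchSwinnertonDyer.…` (summit = problem), as every file of this directory
set_option autoImplicit false

noncomputable section

open scoped Classical MatrixGroups
open Matrix

namespace Summit.BirchSwinnertonDyer.BirchSwinnertonDyer.Theorems.CartanDoubleCoset

open Summit.BirchSwinnertonDyer.BirchSwinnertonDyer.Theorems
open Summit.BirchSwinnertonDyer.BirchSwinnertonDyer.Theorems.CartanDegree (HasRatEigenvalue)
open Summit.BirchSwinnertonDyer.BirchSwinnertonDyer.Theorems.CartanTorusCubeCut (torusSubgroup mem_torusSubgroup lin linGL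
  linGL_coe lin_comm torusSubgroup_isCyclic card_torusSubgroup)
open Summit.BirchSwinnertonDyer.BirchSwinnertonDyer.Theorems.CartanCover.Charext.InertHecke (upperUnip lowerUnip coe_upperUnip
  coe_lowerUnip upperUnip_mul upperUnip_zero exists_unip_factorization)
open Summit.BirchSwinnertonDyer.BirchSwinnertonDyer.Theorems.CartanCover
open Summit.BirchSwinnertonDyer.BirchSwinnertonDyer.Theorems.CartanTorusCubeCut

section BorelGhost

variable {q : ℕ} [Fact q.Prime]

/-! ### §R.4 PROVED: (RBG) THE RATIONAL BOREL GHOST LEMMA -/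

/-- **(RBG) THE RATIONAL BOREL GHOST.** `q ≠ 2`; `W` an IRREDUCIBLE finite-dimensional `ℂ[GL₂(𝔽_q)]`-module with INTEGER-valued character; `w ≠ 0` a vector on
which the upper-triangular Borel subgroup acts by scalars `lam b` and which is fixed by the scalar matrices. Then `lam t ^ 4 = 1 ∨ lam t ^ 6 = 1` at every DIAGONAL `t`.
Proof: `lam` is multiplicative on `B`, `≠ 0`, trivial on `N` (conjugate `n(y)` by `h(2)`) and on scalars; `P = Σ_y ρ(n y)` maps `W = ℂ[G]·w` into `ℂw + ℂu'`,
`u' = P(ρ(weylP) w)` (BRUHAT), with `ρ(t) P w = q·lam(t) w`, `ρ(t) u' = lam(tʷ) u'`, `lam(t) lam(tʷ) = 1`; for non-central `t` every `t·n(y)` is `N`-conjugate to `t`, so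
the JACQUET TRACE IDENTITY `tr(ρ(t) ∘ P) = q · tr ρ(t) ∈ qℤ` reads `lam t ∈ ℤ` (then `= ±1`) or `lam t + (lam t)⁻¹ ∈ ℤ` (then Niven §N.4). Survivors at `q ≡ 1 (3)`, `lam`
non-cubic and non-trivial on the diagonal: the BOREL GHOSTS `χ₂·St`, `𝓑(χ₄, χ₄⁻¹)` (`q ≡ 1 (12)`), `𝓑(χ₆, χ₆⁻¹)`. [cite: Bump1997, §4.1 Thm. 4.1.1 p. 406, Ex. 4.1.2 p. 411] [cite: FultonHarris1991, §5.2] -/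
theorem rationalBorelGhost (hq2 : q ≠ 2) (W : Type*) [AddCommGroup W] [Module ℂ W] [Module.Finite ℂ W]
    (ρ : Representation ℂ (GL (Fin 2) (ZMod q)) W)
    (hirr : ∀ W' : Submodule ℂ W, (∀ g : GL (Fin 2) (ZMod q), ∀ x ∈ W', ρ g x ∈ W') → W' = ⊥ ∨ W' = ⊤)
    (htr : ∀ g : GL (Fin 2) (ZMod q), ∃ n : ℤ, LinearMap.trace ℂ W (ρ g) = (n : ℂ))
    {w : W} (hw0 : w ≠ 0)
    (hZ : ∀ s : GL (Fin 2) (ZMod q), (s : Matrix (Fin 2) (Fin 2) (ZMod q)) 0 1 = 0 → (s : Matrix (Fin 2) (Fin 2) (ZMod q)) 1 0 = 0 →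
      (s : Matrix (Fin 2) (Fin 2) (ZMod q)) 0 0 = (s : Matrix (Fin 2) (Fin 2) (ZMod q)) 1 1 → ρ s w = w)
    {lam : GL (Fin 2) (ZMod q) → ℂ}
    (hwb : ∀ b : GL (Fin 2) (ZMod q), (b : Matrix (Fin 2) (Fin 2) (ZMod q)) 1 0 = 0 → ρ b w = lam b • w)
    (t : GL (Fin 2) (ZMod q)) (ht01 : (t : Matrix (Fin 2) (Fin 2) (ZMod q)) 0 1 = 0) (ht10 : (t : Matrix (Fin 2) (Fin 2) (ZMod q)) 1 0 = 0) :
    lam t ^ 4 = 1 ∨ lam t ^ 6 = 1 := by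
  have hq0 : (q : ℂ) ≠ 0 := Nat.cast_ne_zero.mpr (Fact.out : q.Prime).ne_zero
  have hne : ∀ b : GL (Fin 2) (ZMod q), (b : Matrix (Fin 2) (Fin 2) (ZMod q)) 1 0 = 0 → lam b ≠ 0 := by
    intro b hb h0
    apply hw0
    have h1 : ρ b w = 0 := by rw [hwb b hb, h0, zero_smul]
    have h2 : w = ρ b⁻¹ (ρ b w) := by rw [← Module.End.mul_apply, ← map_mul, inv_mul_cancel, map_one, Module.End.one_apply]
    rw [h2, h1, map_zero]
  have hmul : ∀ b b' : GL (Fin 2) (ZMod q), (b : Matrix (Fin 2) (Fin 2) (ZMod q)) 1 0 = 0 →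
      (b' : Matrix (Fin 2) (Fin 2) (ZMod q)) 1 0 = 0 → lam (b * b') = lam b * lam b' := by
    intro b b' hb hb'
    have h := hwb (b * b') (borel_mul hb hb')
    rw [map_mul, Module.End.mul_apply, hwb b' hb', map_smul, hwb b hb, smul_smul] at h
    exact (smul_left_injective ℂ hw0 h).symm.trans (mul_comm _ _)
  have hN : ∀ y : ZMod q, lam (upperUnip y) = 1 := by
    intro y
    -- lift note (tam3-p1 g43): the source has `two_ne_zero_of_ne_two hq2` here (gate dedup vs `X6.PrintCert.two_ne_zero_zmod`; see `…BorelGhost` §R.1); Mathlib gives `2 ≠ 0`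
    set d2 : (ZMod q)ˣ := Units.mk0 2 (Ring.two_ne_zero (by rw [ZMod.ringChar_zmod_n]; exact hq2)) with hd2
    have e : diagU d2 * upperUnip y = upperUnip y * upperUnip y * diagU d2 := by
      rw [diagU_mul_unip, upperUnip_mul, hd2, Units.val_mk0, two_mul]
    have h := congrArg lam e
    rw [hmul _ _ (diagU_lower d2) (upperUnip_lower y), hmul _ _ (borel_mul (upperUnip_lower y) (upperUnip_lower y)) (diagU_lower d2),
      hmul _ _ (upperUnip_lower y) (upperUnip_lower y)] at h
    have h3 : lam (upperUnip y) * (1 - lam (upperUnip y)) * lam (diagU d2) = 0 := by linear_combination h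
    rcases mul_eq_zero.mp h3 with h4 | h4
    · rcases mul_eq_zero.mp h4 with h5 | h5
      · exact absurd h5 (hne _ (upperUnip_lower y))
      · exact (sub_eq_zero.mp h5).symm
    · exact absurd h4 (hne _ (diagU_lower d2))
  have hwN : ∀ y : ZMod q, ρ (upperUnip y) w = w := fun y => by rw [hwb _ (upperUnip_lower y), hN y, one_smul]
  have hscal : ∀ s : GL (Fin 2) (ZMod q), (s : Matrix (Fin 2) (Fin 2) (ZMod q)) 0 1 = 0 → (s : Matrix (Fin 2) (Fin 2) (ZMod q)) 1 0 = 0 →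
      (s : Matrix (Fin 2) (Fin 2) (ZMod q)) 0 0 = (s : Matrix (Fin 2) (Fin 2) (ZMod q)) 1 1 → lam s = 1 := by
    intro s h01 h10 h00
    have h := hwb s h10
    rw [hZ s h01 h10 h00] at h
    have h' : lam s • w = (1 : ℂ) • w := by rw [one_smul]; exact h.symm
    exact smul_left_injective ℂ hw0 h'
  by_cases hc : (t : Matrix (Fin 2) (Fin 2) (ZMod q)) 0 0 = (t : Matrix (Fin 2) (Fin 2) (ZMod q)) 1 1
  · left
    rw [hscal t ht01 ht10 hc, one_pow]
  set tw : GL (Fin 2) (ZMod q) := weylP * t * weylP with htw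
  have htw_coe := coe_weyl_conj t
  rw [← htw] at htw_coe
  have htw10 : (tw : Matrix (Fin 2) (Fin 2) (ZMod q)) 1 0 = 0 := by rw [htw_coe]; simp [ht01]
  have htw01 : (tw : Matrix (Fin 2) (Fin 2) (ZMod q)) 0 1 = 0 := by rw [htw_coe]; simp [ht10]
  have ht_weylP : t * weylP = weylP * tw := by rw [htw, ← mul_assoc, ← mul_assoc, weylP_mul_weylP, one_mul]
  have hprod : lam t * lam tw = 1 := by
    rw [← hmul t tw ht10 htw10]
    apply hscal <;> rw [Units.val_mul, Matrix.mul_apply, Fin.sum_univ_two] <;> [skip; skip; rw [Matrix.mul_apply, Fin.sum_univ_two]] <;>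
      rw [htw_coe] <;> simp [ht01, ht10, mul_comm]
  set P : W →ₗ[ℂ] W := ∑ y : ZMod q, (ρ (upperUnip y) : W →ₗ[ℂ] W) with hP
  have hPapp : ∀ v : W, P v = ∑ y : ZMod q, ρ (upperUnip y) v := fun v => by rw [hP, LinearMap.sum_apply]
  have hPfix : ∀ v : W, (∀ y : ZMod q, ρ (upperUnip y) v = v) → P v = (q : ℂ) • v := by
    intro v hv
    rw [hPapp, Finset.sum_congr rfl fun y _ => hv y, Finset.sum_const, Finset.card_univ, ZMod.card, Nat.cast_smul_eq_nsmul]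
  have hPN : ∀ (x : ZMod q) (v : W), P (ρ (upperUnip x) v) = P v := by
    intro x v
    rw [hPapp, hPapp]
    have e : ∀ y : ZMod q, ρ (upperUnip y) (ρ (upperUnip x) v) = ρ (upperUnip (y + x)) v := fun y => by
      rw [← Module.End.mul_apply, ← map_mul, upperUnip_mul]
    simp_rw [e]
    exact Fintype.sum_equiv (Equiv.addRight x) _ _ fun y => rfl
  have hNP : ∀ (x : ZMod q) (v : W), ρ (upperUnip x) (P v) = P v := by
    intro x v
    rw [hPapp, map_sum]
    have e : ∀ y : ZMod q, ρ (upperUnip x) (ρ (upperUnip y) v) = ρ (upperUnip (x + y)) v := fun y => by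
      rw [← Module.End.mul_apply, ← map_mul, upperUnip_mul]
    simp_rw [e]
    exact Fintype.sum_equiv (Equiv.addLeft x) _ _ fun y => rfl
  have hTP : ∀ s : GL (Fin 2) (ZMod q), (s : Matrix (Fin 2) (Fin 2) (ZMod q)) 0 1 = 0 → (s : Matrix (Fin 2) (Fin 2) (ZMod q)) 1 0 = 0 →
      ∀ v : W, ρ s (P v) = P (ρ s v) := by
    intro s h01 h10 v
    obtain ⟨c, -, hcy⟩ := exists_diag_unip_comm s h01 h10
    rw [hPapp, hPapp, map_sum]
    have e : ∀ y : ZMod q, ρ s (ρ (upperUnip y) v) = ρ (upperUnip ((c : ZMod q) * y)) (ρ s v) := fun y => by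
      rw [← Module.End.mul_apply, ← map_mul, hcy y, map_mul, Module.End.mul_apply]
    simp_rw [e]
    exact Fintype.sum_equiv (Units.mulLeft c) _ _ fun y => rfl
  set u' : W := P (ρ weylP w) with hu'
  have hu'N : ∀ y : ZMod q, ρ (upperUnip y) u' = u' := fun y => hNP y _
  have htu' : ρ t u' = lam tw • u' := by
    have e : ρ t (ρ weylP w) = lam tw • ρ weylP w := by
      rw [← Module.End.mul_apply, ← map_mul, ht_weylP, map_mul, Module.End.mul_apply, hwb tw htw10, map_smul]
    rw [hu', hTP t ht01 ht10, e, map_smul]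
  have htop : ∀ x : W, x ∈ Submodule.span ℂ (Set.range fun g : GL (Fin 2) (ZMod q) => ρ g w) := by
    set Wo : Submodule ℂ W := Submodule.span ℂ (Set.range fun g : GL (Fin 2) (ZMod q) => ρ g w) with hWo
    have hst : ∀ g : GL (Fin 2) (ZMod q), ∀ x ∈ Wo, ρ g x ∈ Wo := by
      intro g x hx
      have hle : Wo ≤ Wo.comap (ρ g) := by
        refine Submodule.span_le.mpr ?_
        rintro _ ⟨h, rfl⟩
        simp only [SetLike.mem_coe, Submodule.mem_comap]
        rw [← Module.End.mul_apply, ← map_mul]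
        exact Submodule.subset_span ⟨g * h, rfl⟩
      exact hle hx
    have hw : w ∈ Wo := Submodule.subset_span ⟨1, show ρ 1 w = w by rw [map_one, Module.End.one_apply]⟩
    rcases hirr Wo hst with h | h
    · exact absurd ((Submodule.eq_bot_iff _).mp h w hw) hw0
    · intro x
      rw [h]
      exact Submodule.mem_top
  have hPrange : ∀ x : W, ∃ a b : ℂ, P x = a • w + b • u' := by
    intro x
    induction htop x using Submodule.span_induction with
    | mem x hx =>
      obtain ⟨g, rfl⟩ := hx
      dsimp only
      by_cases hg : (g : Matrix (Fin 2) (Fin 2) (ZMod q)) 1 0 = 0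
      · exact ⟨lam g * q, 0, by rw [hwb g hg, map_smul, hPfix w hwN, smul_smul, zero_smul, add_zero]⟩
      · obtain ⟨x, b, hb, rfl⟩ := bruhat_of_ne g hg
        refine ⟨0, lam b, ?_⟩
        rw [map_mul, Module.End.mul_apply, map_mul, Module.End.mul_apply, hwb b hb, map_smul, map_smul, map_smul, hPN, zero_smul, zero_add]
    | zero => exact ⟨0, 0, by simp⟩
    | add x y _ _ hx hy =>
      obtain ⟨a, b, h⟩ := hx
      obtain ⟨a', b', h'⟩ := hy
      exact ⟨a + a', b + b', by rw [map_add, h, h', add_smul, add_smul]; abel⟩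
    | smul c x _ hx =>
      obtain ⟨a, b, h⟩ := hx
      exact ⟨c * a, c * b, by rw [map_smul, h, smul_add, smul_smul, smul_smul]⟩
  obtain ⟨n, hn⟩ := htr t
  have htrace : LinearMap.trace ℂ W (ρ t * P) = (q : ℂ) * n := by
    have e2 : ∀ y : ZMod q, LinearMap.trace ℂ W (ρ (t * upperUnip y)) = n := by
      intro y
      obtain ⟨x, hx⟩ := exists_unip_conj ht01 ht10 hc y
      rw [hx, map_mul ρ, map_mul ρ, LinearMap.trace_mul_comm ℂ (ρ (upperUnip x) * ρ t), ← mul_assoc, ← map_mul ρ, inv_mul_cancel, map_one,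
        one_mul, hn]
    rw [hP, Finset.mul_sum, map_sum,
      Finset.sum_congr rfl fun y _ => show LinearMap.trace ℂ W (ρ t * ρ (upperUnip y)) = (n : ℂ) by rw [← map_mul ρ]; exact e2 y,
      Finset.sum_const, Finset.card_univ, ZMod.card, nsmul_eq_mul]
  have hφw : (ρ t * P) w = ((q : ℂ) * lam t) • w := by
    rw [Module.End.mul_apply, hPfix w hwN, map_smul, hwb t ht10, smul_smul]
  have hφu : (ρ t * P) u' = ((q : ℂ) * lam tw) • u' := by
    rw [Module.End.mul_apply, hPfix u' hu'N, map_smul, htu', smul_smul]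
  have hφrange : ∀ x : W, ∃ a b : ℂ, (ρ t * P) x = a • w + b • u' := fun x => by
    obtain ⟨a, b, h⟩ := hPrange x
    exact ⟨a * lam t, b * lam tw, by rw [Module.End.mul_apply, h, map_add, map_smul, map_smul, hwb t ht10, htu', smul_smul, smul_smul]⟩
  have hone : lam 1 = 1 := hscal 1 (by simp) (by simp) (by simp)
  have hpow : ∀ k : ℕ, lam (t ^ k) = lam t ^ k ∧ ((t ^ k : GL (Fin 2) (ZMod q)) : Matrix (Fin 2) (Fin 2) (ZMod q)) 1 0 = 0 := by
    intro k
    induction k with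
    | zero => exact ⟨by rw [pow_zero, pow_zero, hone], by simp⟩
    | succ k ih =>
      refine ⟨?_, ?_⟩
      · rw [pow_succ, hmul _ _ ih.2 ht10, ih.1, pow_succ]
      · rw [pow_succ]; exact borel_mul ih.2 ht10
  have hroot : lam t ^ orderOf t = 1 := by rw [← (hpow _).1, pow_orderOf_eq_one, hone]
  have hordt : 0 < orderOf t := orderOf_pos t
  have hfin : IsOfFinOrder (lam t) := isOfFinOrder_iff_pow_eq_one.mpr ⟨orderOf t, hordt, hroot⟩
  have hm : 0 < orderOf (lam t) := hfin.orderOf_pos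
  have hprim : IsPrimitiveRoot (lam t) (orderOf (lam t)) := IsPrimitiveRoot.orderOf (lam t)
  by_cases hdep : ∃ c : ℂ, u' = c • w
  · -- `W^N = ℂ w`: `q lam t = q n`, an INTEGER root of unity
    obtain ⟨c, hc'⟩ := hdep
    have hr1 : ∀ x : W, ∃ s : ℂ, (ρ t * P) x = s • w := fun x => by
      obtain ⟨a, b, h⟩ := hφrange x
      exact ⟨a + b * c, by rw [h, hc', smul_smul, add_smul]⟩
    have hlam : lam t = n := by
      have h := (trace_eq_of_range_le_line (ρ t * P) hw0 hr1 hφw).symm.trans htrace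
      exact mul_left_cancel₀ hq0 h
    have hn1 : n ^ orderOf t = 1 := by exact_mod_cast (show (n : ℂ) ^ orderOf t = 1 by rw [← hlam]; exact hroot)
    have hu : n = 1 ∨ n = -1 := Int.isUnit_iff.mp (IsUnit.of_pow_eq_one hn1 hordt.ne')
    left
    rcases hu with h | h <;> rw [hlam, h] <;> norm_num
  · -- `W^N = ℂ w ⊕ ℂ u'`: `q lam t + q lam tʷ = q n`, `lam tʷ = (lam t)⁻¹`, Niven
    have hli : LinearIndependent ℂ ![w, u'] := by
      rw [LinearIndependent.pair_iff]
      intro s r h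
      by_contra hsr
      have hr : r ≠ 0 := by
        intro hr
        apply hsr
        rw [hr, zero_smul, add_zero] at h
        exact ⟨(smul_eq_zero.mp h).resolve_right hw0, hr⟩
      have e : u' = r⁻¹ • (r • u') := by rw [smul_smul, inv_mul_cancel₀ hr, one_smul]
      exact hdep ⟨-(r⁻¹ * s), by rw [e, eq_neg_of_add_eq_zero_right h, smul_neg, smul_smul, _root_.neg_smul]⟩
    have hsum : lam t + (lam t)⁻¹ = n := by
      have h := (trace_eq_of_range_le_pair (ρ t * P) hli hφrange hφw hφu).symm.trans htrace
      rw [← mul_add] at h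
      rw [← eq_inv_of_mul_eq_one_right hprod]
      exact mul_left_cancel₀ hq0 h
    rcases dvd_four_or_dvd_six_of_intTrace hprim hm hsum with h4 | h6
    · exact Or.inl (orderOf_dvd_iff_pow_eq_one.mp h4)
    · exact Or.inr (orderOf_dvd_iff_pow_eq_one.mp h6)


end BorelGhost

end Summit.BirchSwinnertonDyer.BirchSwinnertonDyer.Theorems.CartanDoubleCoset

end
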